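import Summits.KontsevichZagierPeriods.KontsevichZagierPeriods.Theorems.LinRedNormalFormArrangementNormalFormStubRebaseSimplePosPull
import Summits.KontsevichZagierPeriods.KontsevichZagierPeriods.Theorems.LinRedNormalFormArrangementNormalFormStubIntegrateOutLowOrderCells
import Summits.KontsevichZagierPeriods.KontsevichZagierPeriods.Theorems.LinRedNormalFormArrangementNormalFormSeparateCut

/-!
# Stub `stub_rebaseSimplePos` (crux `ArrangementNormalForm`, line `janus-bands`, v6) — part `Cells`

Dissection tools (rule 1a) on the literal class text `GG b σ K`, any base dimension:
* `RebasePos.orderCells` — an order-constrained representation (domain cut out by finitely many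
  strict comparisons between players: fibres and affine forms of the base `(x', y)`) with the
  literal `GG` integrand is a sum of LITERAL `GG b σ K` representations (total-order refinement,
  the `GG`-text version of `ReRead.orderCells_JJ`; for `σ = 2` the letters must be `y`-free and
  the affine players `y`-free or `y` itself) — registered as `rebaseSimplePos_orderCells`;
* `RebasePos.cutBase` — cutting the base cell by a rational affine wall in `(x', y)` keeps the
  literal shape (extra row `±h`), integrand-agnostic.

References: M. Kontsevich, D. Zagier, *Periods* (2001), §1.2, rule (1).
-/

noncomputable section

open Set MeasureTheory MvPolynomial
open Literature.NumberTheory.Transcendental Literature.ModelTheory.ExponentialFields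

namespace Summit.KontsevichZagierPeriods.ArrangementNormalForm.JanusBands

namespace RebasePos

open SeparatePos

section Cells

open IntegrateOutLow

variable {X D : Type} {K : ℕ} (PV : Fin K ⊕ D → X → ℝ) (A : Finset D)
  (C : Finset ((Fin K ⊕ D) × (Fin K ⊕ D)))
  (σ : Fin (Fintype.card (Fin K ⊕ A)) ≃ Fin K ⊕ A)

/-- `IntegrateOutLow.exists_inter_chain_eq` with the bounds remembered as PLAYERS of the chain
(so that properties of the affine data in `A` pass to the bounds). -/
theorem exists_inter_chain_eq' (hc : ∀ c ∈ C, ∃ x₁ x₂ : Fin K ⊕ A,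
      Sum.map id Subtype.val x₁ = c.1 ∧ Sum.map id Subtype.val x₂ = c.2 ∧ σ.symm x₁ < σ.symm x₂)
    (hlu : ∀ v, (∃ c ∈ C, c.2 = Sum.inl v) ∧ (∃ c ∈ C, c.1 = Sum.inl v)) :
    ∃ lo hi : Fin K → Fin K ⊕ A, {x | ∀ c ∈ C, PV c.1 x < PV c.2 x} ∩
      {x | StrictMono fun i => PV (Sum.map id Subtype.val (σ i)) x} =
      {x | (∀ (i : Fin (Fintype.card (Fin K ⊕ A))) (h : i.val + 1 < Fintype.card (Fin K ⊕ A))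
        (d d' : D), Sum.map id Subtype.val (σ i) = Sum.inr d →
        Sum.map id Subtype.val (σ ⟨i.val + 1, h⟩) = Sum.inr d' →
        PV (Sum.inr d) x < PV (Sum.inr d') x) ∧
        ∀ v, PV (Sum.map id Subtype.val (lo v)) x < PV (Sum.inl v) x ∧
          PV (Sum.inl v) x < PV (Sum.map id Subtype.val (hi v)) x} := by
  have hpos : ∀ v, 0 < (σ.symm (Sum.inl v)).val ∧
      (σ.symm (Sum.inl v)).val + 1 < Fintype.card (Fin K ⊕ A) := by
    intro v
    obtain ⟨⟨c, hcC, hc2⟩, ⟨c', hc'C, hc'1⟩⟩ := hlu v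
    obtain ⟨x₁, x₂, -, h2, hlt⟩ := hc c hcC
    obtain ⟨y₁, y₂, h1', -, hlt'⟩ := hc c' hc'C
    rw [hc2] at h2
    rw [hc'1] at h1'
    rw [eq_inl_of_map_eq A h2] at hlt
    rw [eq_inl_of_map_eq A h1'] at hlt'
    exact ⟨lt_of_le_of_lt (Nat.zero_le _) hlt,
      lt_of_le_of_lt (Nat.succ_le_of_lt hlt') (σ.symm y₂).2⟩
  refine ⟨fun v => σ ⟨(σ.symm (Sum.inl v)).val - 1,
      lt_of_le_of_lt (Nat.sub_le _ _) (σ.symm (Sum.inl v)).2⟩,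
    fun v => if h : (σ.symm (Sum.inl v)).val + 1 < Fintype.card (Fin K ⊕ A) then
      σ ⟨(σ.symm (Sum.inl v)).val + 1, h⟩ else Sum.inl v, ?_⟩
  ext z
  simp only [mem_inter_iff, mem_setOf_eq]
  constructor
  · rintro ⟨hz, hcell⟩
    have hf : ∀ i j, i < j → PV (Sum.map id Subtype.val (σ i)) z <
        PV (Sum.map id Subtype.val (σ j)) z := fun i j hij => hcell hij
    refine ⟨fun i hi d d' hd hd' => ?_, fun v => ⟨?_, ?_⟩⟩
    · have h := hf i ⟨i.val + 1, hi⟩ (by rw [Fin.lt_def]; exact Nat.lt_succ_self _)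
      rwa [hd, hd'] at h
    · have hpv := hf ⟨(σ.symm (Sum.inl v)).val - 1, lt_of_le_of_lt (Nat.sub_le _ _)
        (σ.symm (Sum.inl v)).2⟩ (σ.symm (Sum.inl v))
        (by rw [Fin.lt_def]; have := (hpos v).1; dsimp only; omega)
      rwa [Equiv.apply_symm_apply] at hpv
    · rw [dif_pos (hpos v).2]
      have hpv := hf (σ.symm (Sum.inl v)) ⟨(σ.symm (Sum.inl v)).val + 1, (hpos v).2⟩
        (by rw [Fin.lt_def]; exact Nat.lt_succ_self _)
      rwa [Equiv.apply_symm_apply] at hpv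
  · rintro ⟨hrow, hfib⟩
    have hadj : ∀ i : Fin (Fintype.card (Fin K ⊕ A)), ∀ hi : i.val + 1 < Fintype.card (Fin K ⊕ A),
        PV (Sum.map id Subtype.val (σ i)) z <
          PV (Sum.map id Subtype.val (σ ⟨i.val + 1, hi⟩)) z := by
      intro i hi
      rcases hσi : σ i with v | ⟨d, hd⟩
      · have hp : σ.symm (Sum.inl v) = i := by rw [← hσi, Equiv.symm_apply_apply]
        have h2 := (hfib v).2
        simp only [hp, dif_pos hi] at h2
        exact h2
      · rcases hσi' : σ ⟨i.val + 1, hi⟩ with v' | ⟨d', hd'⟩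
        · have hp : σ.symm (Sum.inl v') = ⟨i.val + 1, hi⟩ := by
            rw [← hσi', Equiv.symm_apply_apply]
          have h1 := (hfib v').1
          simp only [hp, Nat.add_sub_cancel, Fin.eta, hσi] at h1
          exact h1
        · exact hrow i hi d d' (by rw [hσi]; rfl) (by rw [hσi']; rfl)
    have hsm : StrictMono fun i => PV (Sum.map id Subtype.val (σ i)) z := strictMono_of_succ_lt hadj
    refine ⟨fun c hcC => ?_, hsm⟩
    obtain ⟨x₁, x₂, hx₁, hx₂, hlt⟩ := hc c hcC
    have h := hsm hlt
    simp only [Equiv.apply_symm_apply, hx₁, hx₂] at h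
    exact h

variable {b : ℕ}

/-- **Order-constrained representations with the literal `GG` integrand are sums of literal
`GG b σ K` representations** (rule 1a, total-order refinement; the `GG`-text version of
`ReRead.orderCells_JJ`). The domain is cut out by finitely many strict comparisons between
players (fibres `tᵢ` and affine forms of the base `(x', y)`), every fibre being compared at
least once from below and from above; for `σ = 2` the letters must be `y`-free and every affine
player `y`-free or `y` itself. -/
theorem orderCells {m n₁ n₂ : ℕ} (σ₀ : ℕ) (s : KZ.IntegralRep (b + 1 + K))
    (C : Finset ((Fin K ⊕ ((Fin (b + 1) → ℚ) × ℚ)) × (Fin K ⊕ ((Fin (b + 1) → ℚ) × ℚ))))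
    (L : Fin m → (Fin b → ℚ) × ℚ) (e : Fin m → ℕ) (p : MvPolynomial (Fin b) ℚ)
    (ℓ₁ ℓ₂ : (Fin b → ℚ) × ℚ) (a : Fin K → Option ((Fin (b + 1) → ℚ) × ℚ))
    (h12 : n₁ = 0 ∨ n₂ = 0) (hbd : Bornology.IsBounded s.domain)
    (hlu : ∀ v, (∃ q ∈ C, q.2 = Sum.inl v) ∧ (∃ q ∈ C, q.1 = Sum.inl v))
    (hdom : s.domain = {z | ∀ q ∈ C, pv q.1 z < pv q.2 z})
    (hint : EqOn s.integrand (glit b K p L e ℓ₁ ℓ₂ n₁ n₂ a) s.domain)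
    (hσ₀ : σ₀ = 2 → (∀ i c, a i = some c → c.1 (Fin.last b) = 0) ∧
      (∀ q ∈ C, ∀ d, (q.1 = Sum.inr d ∨ q.2 = Sum.inr d) →
        (d.1 (Fin.last b) = 0 ∨ d = (Pi.single (Fin.last b) 1, 0)))) :
    ∃ c ∈ AddSubgroup.closure (GGset b σ₀ K), KZ.of s - c ∈ KZ.relations := by
  classical
  set A : Finset ((Fin (b + 1) → ℚ) × ℚ) :=
    C.biUnion fun q => q.1.getRight?.toFinset ∪ q.2.getRight?.toFinset with hA_def
  have hA : ∀ q ∈ C, ∀ d, (q.1 = Sum.inr d ∨ q.2 = Sum.inr d) → d ∈ A := by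
    intro q hq d h
    rw [hA_def, Finset.mem_biUnion]
    refine ⟨q, hq, ?_⟩
    rcases h with h | h <;> simp [h]
  have hA' : ∀ d ∈ A, ∃ q ∈ C, q.1 = Sum.inr d ∨ q.2 = Sum.inr d := by
    intro d hd
    rw [hA_def, Finset.mem_biUnion] at hd
    obtain ⟨q, hq, h⟩ := hd
    refine ⟨q, hq, ?_⟩
    rwa [Finset.mem_union, Option.mem_toFinset, Option.mem_toFinset, Option.mem_def,
      Option.mem_def, Sum.getRight?_eq_some_iff, Sum.getRight?_eq_some_iff] at h
  set P : Fin K ⊕ A → MvPolynomial (Fin (b + 1 + K)) ℚ := fun x =>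
    Sum.elim (fun v => (X (Fin.natAdd (b + 1) v) : MvPolynomial (Fin (b + 1 + K)) ℚ))
      (fun d => rename (Fin.castAdd K) (∑ i, MvPolynomial.C (d.1 i) * X i + MvPolynomial.C d.2))
      (Sum.map id Subtype.val x) with hP_def
  have hval : ∀ x z, aeval z (P x) = pv (Sum.map id Subtype.val x) z := fun x z =>
    aeval_player _ z
  have hP : ∀ x y, x ≠ y → ∃ z, aeval z (P x) ≠ aeval z (P y) := fun x y hxy => by
    obtain ⟨z, hz⟩ := player_ne (b := b + 1) (K := K) (fun h => hxy
      (Sum.map_injective.2 ⟨fun _ _ h => h, Subtype.val_injective⟩ h))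
    exact ⟨z, by rwa [hval, hval]⟩
  have hsplit := of_sub_sum_cell_mem_relations P hP s
  have hcell : ∀ σ : Fin (Fintype.card (Fin K ⊕ A)) ≃ Fin K ⊕ A,
      {z : Fin (b + 1 + K) → ℝ | StrictMono fun i => aeval z (P (σ i))} =
      {z | StrictMono fun i => pv (Sum.map id Subtype.val (σ i)) z} := fun σ => by
    simp_rw [hval]
  set piece := fun σ : Fin (Fintype.card (Fin K ⊕ A)) ≃ Fin K ⊕ A =>
    s.restrict (s.domain ∩ {z | StrictMono fun i => aeval z (P (σ i))})
      (s.isSemialgebraic_domain.inter (isSemialgebraic_cell P σ)) inter_subset_left with hpiece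
  set good := fun σ : Fin (Fintype.card (Fin K ⊕ A)) ≃ Fin K ⊕ A =>
    ∀ q ∈ C, ∃ x₁ x₂ : Fin K ⊕ A, Sum.map id Subtype.val x₁ = q.1 ∧
      Sum.map id Subtype.val x₂ = q.2 ∧ σ.symm x₁ < σ.symm x₂ with hgood_def
  have hgood : ∀ σ, good σ → KZ.of (piece σ) ∈ GGset b σ₀ K := by
    intro σ hσ
    obtain ⟨lo', hi', hEq⟩ := exists_inter_chain_eq' pv A C σ hσ hlu
    refine ⟨m, Fintype.card (Fin K ⊕ A), n₁, n₂, piece σ, fun i =>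
      if h : i.val + 1 < Fintype.card (Fin K ⊕ A) then
        Sum.elim (fun _ => ((0 : Fin (b + 1) → ℚ), (1 : ℚ))) (fun d => Sum.elim (fun _ => (0, 1))
          (fun d' => (d'.1 - d.1, d'.2 - d.2)) (Sum.map id Subtype.val (σ ⟨i.val + 1, h⟩)))
          (Sum.map id Subtype.val (σ i)) else (0, 1),
      L, e, p, ℓ₁, ℓ₂, a, fun v => Sum.map id Subtype.val (lo' v),
      fun v => Sum.map id Subtype.val (hi' v), h12, fun h2 => ⟨(hσ₀ h2).1, fun i d hd => ?_⟩,
      hbd.subset inter_subset_left, ?_, hint.mono inter_subset_left, rfl⟩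
    · have hmem : ∀ x : Fin K ⊕ A, Sum.map id Subtype.val x = Sum.inr d → d ∈ A := by
        rintro (v | ⟨d₀, hd₀⟩) h
        · simp at h
        · simp only [Sum.map_inr, Sum.inr.injEq] at h
          exact h ▸ hd₀
      have hdA : d ∈ A := by
        rcases hd with hd | hd
        · exact hmem _ hd
        · exact hmem _ hd
      obtain ⟨q, hq, hq'⟩ := hA' d hdA
      exact (hσ₀ h2).2 q hq d hq'
    · show s.domain ∩ {z | StrictMono fun i => aeval z (P (σ i))} = _
      rw [hdom, hcell σ, hEq]
      ext z
      simp only [mem_setOf_eq]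
      refine and_congr ⟨fun h j => ?_, fun h i hi d d' h1 h2 => ?_⟩ Iff.rfl
      · by_cases hj : j.val + 1 < Fintype.card (Fin K ⊕ A)
        · rw [dif_pos hj]
          rcases h1 : Sum.map id Subtype.val (σ j) with v | d
          · simp
          · rcases h2 : Sum.map id Subtype.val (σ ⟨j.val + 1, hj⟩) with v' | d'
            · simp
            · have hlt := h j hj d d' h1 h2
              simp only [Sum.elim_inr, Pi.sub_apply, sub_row_pos_iff]
              exact hlt
        · rw [dif_neg hj]
          simp
      · have hr := h i
        rw [dif_pos hi, h1, h2] at hr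
        simp only [Sum.elim_inr, Pi.sub_apply, sub_row_pos_iff] at hr
        exact hr
  have hbad : ∀ σ, ¬ good σ → KZ.of (piece σ) ∈ KZ.relations := by
    intro σ hσ
    refine KZ.of_mem_relations_of_volume_eq_zero _ ?_
    show volume (s.domain ∩ {z | StrictMono fun i => aeval z (P (σ i))}) = 0
    rw [hdom, hcell σ, inter_chain_eq_empty pv A C hA σ hσ, measure_empty]
  refine ⟨∑ σ ∈ Finset.univ.filter good, KZ.of (piece σ), AddSubgroup.sum_mem _ fun σ hσ =>
      AddSubgroup.subset_closure (hgood σ (Finset.mem_filter.1 hσ).2), ?_⟩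
  rw [← Finset.sum_filter_add_sum_filter_not Finset.univ good] at hsplit
  have hb : ∑ σ ∈ Finset.univ.filter (fun σ => ¬ good σ), KZ.of (piece σ) ∈ KZ.relations :=
    sum_mem fun σ hσ => hbad σ (Finset.mem_filter.1 hσ).2
  convert KZ.relations.add_mem hsplit hb using 1
  abel

end Cells

section Cut

variable {b K m' : ℕ}

/-- **Cutting the base cell by a rational affine wall in `(x', y)`** (rule 1a; the `GG`-text,
integrand-agnostic version of `separatePos_cut`): the restrictions to `{h > 0}` and `{h < 0}`
have literal domains with the extra row `±h`, the same integrand, and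
`[s] − [s₁] − [s₂] ∈ KZ.relations` (the wall is null). -/
theorem cutBase (s : KZ.IntegralRep (b + 1 + K)) (M : Fin m' → (Fin (b + 1) → ℚ) × ℚ)
    (lo hi : Fin K → Fin K ⊕ ((Fin (b + 1) → ℚ) × ℚ)) (hdom : s.domain = gDom b K m' M lo hi)
    (h : (Fin (b + 1) → ℚ) × ℚ) (hh : h ≠ 0) :
    ∃ s₁ s₂ : KZ.IntegralRep (b + 1 + K),
      (∀ z, z ∈ s₁.domain ↔ z ∈ s.domain ∧ 0 < affF b K h z) ∧
      (∀ z, z ∈ s₂.domain ↔ z ∈ s.domain ∧ affF b K h z < 0) ∧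
      s₁.integrand = s.integrand ∧ s₂.integrand = s.integrand ∧
      s₁.domain = gDom b K (m' + 1) (Fin.snoc M h) lo hi ∧
      s₂.domain = gDom b K (m' + 1) (Fin.snoc M (-h)) lo hi ∧
      KZ.of s - KZ.of s₁ - KZ.of s₂ ∈ KZ.relations := by
  have key : ∀ (g : (Fin (b + 1) → ℚ) × ℚ) (z : Fin (b + 1 + K) → ℝ),
      z ∈ gDom b K (m' + 1) (Fin.snoc M g) lo hi ↔ z ∈ s.domain ∧ 0 < affF b K g z := fun g z => by
    rw [hdom]
    simp only [gDom, affF, mem_setOf_eq, Fin.forall_fin_succ', Fin.snoc_castSucc, Fin.snoc_last]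
    tauto
  set D₁ := gDom b K (m' + 1) (Fin.snoc M h) lo hi with hD₁
  set D₂ := gDom b K (m' + 1) (Fin.snoc M (-h)) lo hi with hD₂
  have hneg : ∀ z, affF b K (-h) z = -affF b K h z := fun z => by
    simp only [affF, Prod.fst_neg, Prod.snd_neg, Pi.neg_apply, Rat.cast_neg, neg_mul,
      Finset.sum_neg_distrib]
    ring
  have hmem₁ : ∀ z, z ∈ D₁ ↔ z ∈ s.domain ∧ 0 < affF b K h z := key h
  have hmem₂ : ∀ z, z ∈ D₂ ↔ z ∈ s.domain ∧ affF b K h z < 0 := fun z => by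
    rw [hD₂, key (-h) z, hneg, neg_pos]
  have hsub₁ : D₁ ⊆ s.domain := fun z hz => ((hmem₁ z).1 hz).1
  have hsub₂ : D₂ ⊆ s.domain := fun z hz => ((hmem₂ z).1 hz).1
  set s₁ := s.restrict D₁ (isSemialgebraic_gDom _ _ _ _) hsub₁ with hs₁
  set s₂ := s.restrict D₂ (isSemialgebraic_gDom _ _ _ _) hsub₂ with hs₂
  have hnull : volume {z : Fin (b + 1 + K) → ℝ | affF b K h z = 0} = 0 :=
    volume_form_eq_zero (k := K) h hh
  have hrel : KZ.of s - KZ.of s₁ - KZ.of s₂ ∈ KZ.relations := by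
    have h0 := KZ.of_sub_sum_of_mem_relations (Finset.univ : Finset (Fin 2)) s ![s₁, s₂]
      (fun i _ => by
        fin_cases i
        · simp [hs₁, sdiff_eq_empty.mpr hsub₁]
        · simp [hs₂, sdiff_eq_empty.mpr hsub₂])
      (fun i _ => by fin_cases i <;> exact fun _ _ => rfl)
      (by
        refine measure_mono_null (fun z hz => ?_) hnull
        simp only [mem_sdiff, mem_iUnion, Finset.mem_univ, exists_true_left, not_exists,
          Fin.forall_fin_two, Matrix.cons_val_zero, Matrix.cons_val_one] at hz
        obtain ⟨hz, h1, h2⟩ := hz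
        have h1' : ¬ 0 < affF b K h z := fun hp => h1 ((hmem₁ z).2 ⟨hz, hp⟩)
        have h2' : ¬ affF b K h z < 0 := fun hn => h2 ((hmem₂ z).2 ⟨hz, hn⟩)
        simp only [mem_setOf_eq]
        linarith)
      (fun i _ j _ hij => by
        fin_cases i <;> fin_cases j
        · exact absurd rfl hij
        · refine measure_mono_null (fun z hz => ?_) measure_empty
          have hp := ((hmem₁ z).1 hz.1).2
          have hn := ((hmem₂ z).1 hz.2).2
          linarith
        · refine measure_mono_null (fun z hz => ?_) measure_empty
          have hn := ((hmem₂ z).1 hz.1).2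
          have hp := ((hmem₁ z).1 hz.2).2
          linarith
        · exact absurd rfl hij)
    rw [Fin.sum_univ_two] at h0
    simpa [sub_sub] using h0
  exact ⟨s₁, s₂, hmem₁, hmem₂, rfl, rfl, rfl, rfl, hrel⟩

end Cut

end RebasePos

/-- Registered support goal of this file: total-order refinement of order-constrained `GG`-text
representations into literal `GG b σ K` cells (`RebasePos.orderCells`). -/
theorem rebaseSimplePos_orderCells (b K m n₁ n₂ σ₀ : ℕ) (s : KZ.IntegralRep (b + 1 + K)) (C : Finset ((Fin K ⊕ ((Fin (b + 1) → ℚ) × ℚ)) × (Fin K ⊕ ((Fin (b + 1) → ℚ) × ℚ)))) (L : Fin m → (Fin b → ℚ) × ℚ) (e : Fin m → ℕ) (p : MvPolynomial (Fin b) ℚ) (ℓ₁ ℓ₂ : (Fin b → ℚ) × ℚ) (a : Fin K → Option ((Fin (b + 1) → ℚ) × ℚ)) (h12 : n₁ = 0 ∨ n₂ = 0) (hbd : Bornology.IsBounded s.domain) (hlu : ∀ v, (∃ q ∈ C, q.2 = Sum.inl v) ∧ (∃ q ∈ C, q.1 = Sum.inl v)) (hdom : s.domain = {z | ∀ q ∈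 C, RebasePos.pv q.1 z < RebasePos.pv q.2 z}) (hint : EqOn s.integrand (RebasePos.glit b K p L e ℓ₁ ℓ₂ n₁ n₂ a) s.domain) (hσ₀ : σ₀ = 2 → (∀ i c, a i = some c → c.1 (Fin.last b) = 0) ∧ (∀ q ∈ C, ∀ d, (q.1 = Sum.inr d ∨ q.2 = Sum.inr d) → (d.1 (Fin.last b) = 0 ∨ d = (Pi.single (Fin.last b) 1, 0)))) : ∃ c ∈ AddSubgroup.closure (SeparatePos.GGset b σ₀ K), KZ.of s - c ∈ KZ.relations :=
  RebasePos.orderCells σ₀ s C L e p ℓ₁ ℓ₂ a h12 hbd hlu hdom hint hσ₀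

end Summit.KontsevichZagierPeriods.ArrangementNormalForm.JanusBands
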